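import Literature.AlgebraicTopology.SingularHomology.CechCapProduct
import Literature.AlgebraicTopology.SingularHomology.CechCapChain
import Literature.AlgebraicTopology.SingularHomology.CechMayerVietoris
import Literature.AlgebraicTopology.SingularHomology.LocalHomologyMayerVietoris
import Mathlib.Algebra.FiveLemma
import HarnessLib

/-!
# The Čech–homology Mayer–Vietoris ladder of the cap product (Miller Thm. 36.2) and the
Mayer–Vietoris step of Čech–Alexander–Poincaré duality (proof of Thm. 37.1)

H. Miller, *Lectures on Algebraic Topology* (2020), Thm. 36.2: for `A`, `B` compact in a Hausdorff
space `X` and `x_{A∪B} ∈ Hₙ(X, X − A ∪ B)` with restrictions `x_A`, `x_B`, `x_{A∩B}`, the Čech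
cohomology and singular (local) homology Mayer–Vietoris sequences are compatible under the cap
products `- ⌢ x_K : Ȟ^p(K) → H_q(X | K)`, with the "memorable formula" `(δb) ⌢ x_K = ∂(b ⌢ x_L)`
(p. 119) for the connecting maps; and proof of Thm. 37.1, steps (2), (4): "This follows by
induction and the five lemma applied to the Mayer–Vietoris ladder 36.2."

For the tree's Čech cap product `cechCap` (`CechCapProduct.lean`, coefficients
`𝑹 = SimplexSpan.coefR R = ULift R`, so that `X : Type u` and `R : Type v` are independent), the
Čech Mayer–Vietoris sequence (`CechMayerVietoris.lean`) and the relative Mayer–Vietoris sequence of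
local homology (`LocalHomologyMayerVietoris.lean`):

* `CechDuality.exists_coverRep` — representatives `z₁ + z₂ + z₃` of `Hₙ(X | A ∪ B)` adapted to a
  pair of neighbourhoods `A ⊆ W`, `B ⊆ Y` (`z₁` in `W ∩ Y`, `z₂` in `W ∖ B`, `z₃` in `Y ∖ A`; small
  chains for the cover `{W ∩ Y, W ∖ B, Y ∖ A, X ∖ (A ∪ B)}`, Hatcher Prop. 2.21);
* `subsetCochains.snakeCochain`, `shortExact_δ_cls`, `homologyMap_resSup_mvδ` — the cohomology
  Mayer–Vietoris connecting map on representatives (snake lemma with the lift `(g, 0)`,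
  `g` = the extension of a cocycle of `W ∩ Y` to `W` by zero);
* `CechDuality.cechCap_mvδ` — **the third square**: `(δb) ⌢ x = (-1)^{p+1} ∂(b ⌢ x|_{A∩B})`,
  by an explicit chain-level computation on adapted representatives (Hatcher, §3.3, Lemma 3.36
  for the analogous ladder in the proof of Poincaré duality);
* `CechDuality.mvRes_comp_cechCap`, `mvDiff_comp_prodMap_cechCap`, `mvδ_comp_smul_cechCap` — the
  three squares as identities of linear maps; `Cech.mvRes_zero_injective` (the ladder starts with
  `0 → Ȟ⁰(A ∪ B)`);
* `CechDuality.bijective_cechCap_union` — **the Mayer–Vietoris step**: if capping with `x|_A`,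
  `x|_B`, `x|_{A∩B}` is bijective in all degrees (and `Hₙ(X | A ∪ B) → Hₙ(X | A) × Hₙ(X | B)` is
  injective, as when `H_{n+1}(X | A ∩ B) = 0`), then capping with `x` is bijective in all degrees
  (Mathlib's five lemma `LinearMap.bijective_of_surjective_of_bijective_of_bijective_of_injective`,
  and the four lemma at the left end for `Ȟ⁰`).

Everything is proved; no named facts.

## References

* H. Miller, *Lectures on Algebraic Topology*, World Scientific 2020, Thm. 36.2, p. 119; proof of
  Thm. 37.1. [Miller2020]
* A. Hatcher, *Algebraic Topology*, CUP 2002, §2.2 p. 150, §3.1 p. 204, §3.3 Lemma 3.36. [HatcherAT2002]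
-/

noncomputable section

-- as in `SingularChainsConcrete` / `LocalCapProduct`: chains of the concrete complex are `Finsupp`s
-- up to unfolding semireducible definitions
set_option backward.isDefEq.respectTransparency false

open CategoryTheory Limits

universe u v w

namespace Literature.AlgebraicTopology.SingularHomology

/-! ### Algebra: two adapters -/

section Algebra

variable {R : Type v} [CommRing R]

/-- `relCls x = relCls y` from a bounding chain in an explicit degree `j` with `c.prev i = j`
(`relCls_eq_relCls_iff`). [folklore] -/
lemma Subcomplex.relCls_eq_relCls_of_prev {ι' : Type*} {c' : ComplexShape ι'}
    {K : HomologicalComplex (ModuleCat.{w} R) c'} {S : Subcomplex K} {i j : ι'} (hj : c'.prev i = j)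
    (x y : K.X i) (hx : K.d i (c'.next i) x ∈ S (c'.next i)) (hy : K.d i (c'.next i) y ∈ S (c'.next i))
    (w' : K.X j) (hw : K.d j i w' - (x - y) ∈ S i) : S.relCls x hx = S.relCls y hy := by
  subst hj
  exact (S.relCls_eq_relCls_iff x y hx hy).mpr ⟨w', hw⟩

/-- `(-1)ᵏ • (-1)ᵏ • x = x`. [folklore] -/
lemma neg_one_pow_smul_neg_one_pow_smul {V : Type*} [AddCommGroup V] [Module R V] (k : ℕ) (x : V) :
    (-1 : R) ^ k • (-1 : R) ^ k • x = x := by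
  rw [smul_smul, ← pow_add, ← two_mul, pow_mul, neg_one_sq, one_pow, one_smul]

/-- For a short exact sequence of complexes of modules: if `f(x₁) = d x₂` then `x₁` is a cycle
(the cycle condition in the snake lemma, by injectivity of `f`). [folklore] -/
lemma ShortComplex.d_eq_zero_of_f_eq_d {ι' : Type*} {c' : ComplexShape ι'}
    {S : ShortComplex (HomologicalComplex (ModuleCat.{w} R) c')}
    (hS : S.ShortExact) {i j k : ι'} (x₂ : S.X₂.X i) (x₁ : S.X₁.X j)
    (hx₁ : S.f.f j x₁ = S.X₂.d i j x₂) : S.X₁.d j k x₁ = 0 := by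
  haveI := hS.mono_f
  have hinj : Function.Injective (S.f.f k) := (ModuleCat.mono_iff_injective _).mp inferInstance
  apply hinj
  have h := ConcreteCategory.congr_hom (S.f.comm j k) x₁
  rw [ModuleCat.comp_apply, ModuleCat.comp_apply] at h
  rw [map_zero, ← h, hx₁, ← ModuleCat.comp_apply, S.X₂.d_comp_d]
  rfl

end Algebra

/-! ### Representatives of `Hₙ(X | A ∪ B)` adapted to a pair of neighbourhoods -/

namespace CechDuality

variable {R : Type v} [CommRing R] {M : Type v} [AddCommGroup M] [Module R M]
variable {X : Type u} [TopologicalSpace X]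

/-- The open cover `{W ∩ Y, W ∖ B, Y ∖ A, X ∖ (A ∪ B)}` of `X` attached to closed `A ⊆ W`, `B ⊆ Y`
(`W`, `Y` open). [folklore] -/
def coverSets (W Y A B : Set X) : Fin 4 → Set X := ![W ∩ Y, W ∩ Bᶜ, Y ∩ Aᶜ, (A ∪ B)ᶜ]

/-- The four sets are open. [folklore] -/
lemma isOpen_coverSets {W Y A B : Set X} (hW : IsOpen W) (hY : IsOpen Y) (hA : IsClosed A)
    (hB : IsClosed B) : ∀ i, IsOpen (coverSets W Y A B i) := by
  intro i
  fin_cases i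
  · exact hW.inter hY
  · exact hW.inter hB.isOpen_compl
  · exact hY.inter hA.isOpen_compl
  · exact (hA.union hB).isOpen_compl

omit [TopologicalSpace X] in
/-- The four sets cover `X`. [folklore] -/
lemma univ_subset_iUnion_coverSets {W Y A B : Set X} (hAW : A ⊆ W) (hBY : B ⊆ Y) :
    (Set.univ : Set X) ⊆ ⋃ i, coverSets W Y A B i := by
  intro x _
  rw [Set.mem_iUnion]
  by_cases hxW : x ∈ W
  · by_cases hxY : x ∈ Y
    · exact ⟨0, hxW, hxY⟩
    · exact ⟨1, hxW, fun hxB => hxY (hBY hxB)⟩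
  · by_cases hxY : x ∈ Y
    · exact ⟨2, hxY, fun hxA => hxW (hAW hxA)⟩
    · refine ⟨3, ?_⟩
      change x ∈ (A ∪ B)ᶜ
      rintro (hxA | hxB)
      · exact hxW (hAW hxA)
      · exact hxY (hBY hxB)

omit [TopologicalSpace X] in
/-- An element of a supremum of four submodules is a sum of four elements. [folklore] -/
lemma exists_of_mem_iSup_fin_four {V : Type*} [AddCommGroup V] [Module R V] (N : Fin 4 → Submodule R V)
    {x : V} (hx : x ∈ ⨆ i, N i) :
    ∃ x₀ x₁ x₂ x₃ : V, x₀ ∈ N 0 ∧ x₁ ∈ N 1 ∧ x₂ ∈ N 2 ∧ x₃ ∈ N 3 ∧ x₀ + x₁ + x₂ + x₃ = x := by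
  obtain ⟨f, hf, rfl⟩ := (Submodule.mem_iSup_iff_exists_finsupp N x).mp hx
  refine ⟨f 0, f 1, f 2, f 3, hf 0, hf 1, hf 2, hf 3, ?_⟩
  rw [Finsupp.sum_fintype _ _ (fun _ => rfl), Fin.sum_univ_four]

/-- **Adapted representatives of `Hₙ(X | A ∪ B)`**: for closed `A ⊆ W`, `B ⊆ Y` (`W`, `Y` open),
every class of `Hₙ(X | A ∪ B)` is represented by `z₁ + z₂ + z₃` with `z₁` in `W ∩ Y`, `z₂` in
`W ∖ B` and `z₃` in `Y ∖ A` (small chains for the cover `{W ∩ Y, W ∖ B, Y ∖ A, X ∖ (A ∪ B)}`,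
Hatcher Prop. 2.21, the last summand being discarded). [folklore] -/
theorem exists_coverRep {W Y A B : Set X} (hW : IsOpen W) (hY : IsOpen Y) (hA : IsClosed A)
    (hB : IsClosed B) (hAW : A ⊆ W) (hBY : B ⊆ Y) {n : ℕ} (μ : clocalHomology R M X (A ∪ B) n) :
    ∃ z₁ z₂ z₃ : (csingularChainComplex R M X).X n,
      z₁ ∈ chainsIn R M X (W ∩ Y) n ∧ z₂ ∈ chainsIn R M X (W ∩ Bᶜ) n ∧ z₃ ∈ chainsIn R M X (Y ∩ Aᶜ) n ∧
      ∃ hz : (csingularChainComplex R M X).d n ((ComplexShape.down ℕ).next n) (z₁ + z₂ + z₃) ∈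
          awaySub R M X (A ∪ B) ((ComplexShape.down ℕ).next n),
        (awaySub R M X (A ∪ B)).relCls (z₁ + z₂ + z₃) hz = μ := by
  set T := smallSub R M X (coverSets W Y A B) with hT
  set S := awaySub R M X (A ∪ B) with hS
  have hST : S ≤ T := fun k c hc => by
    change c ∈ smallChains R M X (coverSets W Y A B) k
    exact Submodule.mem_iSup_of_mem (3 : Fin 4) hc
  have hsup : S ⊔ T = T := sup_eq_right.mpr hST
  have hiso : ∀ k, IsIso (HomologicalComplex.homologyMap (S ⊔ T).ι k) := fun k => by
    haveI := isIso_homologyMap_ι_smallSub R M (coverSets W Y A B) (isOpen_coverSets hW hY hA hB)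
      (univ_subset_iUnion_coverSets hAW hBY) k
    haveI := Subcomplex.isIso_incl_of_eq hsup
    rw [← Subcomplex.incl_ι hsup.le, HomologicalComplex.homologyMap_comp]
    infer_instance
  haveI := Subcomplex.isIso_homologyMap_quotMap_of_sup S T n (hiso n) (fun j _ => by
    haveI := hiso j; infer_instance)
  set e := HomologicalComplex.homologyMap (Subcomplex.quotMap T.ι (S.comap T.ι) S le_rfl) n with he
  obtain ⟨a, rfl⟩ := (asIso e).toLinearEquiv.surjective μ
  obtain ⟨y, hy, rfl⟩ := Subcomplex.relCls_surjective _ a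
  obtain ⟨x₀, x₁, x₂, x₃, hx₀, hx₁, hx₂, hx₃, hsum⟩ :=
    exists_of_mem_iSup_fin_four (R := R) (V := (csingularChainComplex R M X).X n)
      (fun i => chainsIn R M X (coverSets W Y A B i) n) y.2
  have hy' : (csingularChainComplex R M X).d n ((ComplexShape.down ℕ).next n) y.1 ∈
      S ((ComplexShape.down ℕ).next n) := by
    have h := hy
    rw [Subcomplex.mem_comap, Subcomplex.ι_f_apply, Subcomplex.toComplex_d_apply_val] at h
    exact h
  have hx₃' : x₃ ∈ S n := hx₃
  have hz : (csingularChainComplex R M X).d n ((ComplexShape.down ℕ).next n) (x₀ + x₁ + x₂) ∈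
      S ((ComplexShape.down ℕ).next n) := by
    have e3 : x₀ + x₁ + x₂ = y.1 - x₃ := by rw [← hsum]; abel
    rw [e3, map_sub]
    exact Submodule.sub_mem _ hy' (S.d_mem hx₃')
  refine ⟨x₀, x₁, x₂, hx₀, hx₁, hx₂, hz, ?_⟩
  symm
  change e _ = _
  rw [he, Subcomplex.homologyMap_quotMap_relCls, Subcomplex.relCls_eq_relCls_iff]
  refine ⟨0, ?_⟩
  rw [map_zero, zero_sub]
  have e4 : T.ι.f n y - (x₀ + x₁ + x₂) = x₃ := by rw [Subcomplex.ι_f_apply, ← hsum]; abel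
  rw [e4]
  exact Submodule.neg_mem _ hx₃'

end CechDuality

/-! ### The cohomology Mayer–Vietoris connecting map on representatives -/

namespace subsetCochains

variable {R : Type v} [CommRing R] {X : Type u} [TopologicalSpace X]

/-- Local notation: the coefficient object `ULift R` of `ModuleCat.{max u v} R` (`CechCapProduct.lean`). -/
local notation "𝑹" => SimplexSpan.coefR R

section Snake

variable {W Y : Set X} {p : ℕ}

/-- A `p`-cochain of `Hom(C(U), N)` viewed as the morphism `C(U)ₚ ⟶ N` it is. [folklore] -/
abbrev asHom {N : ModuleCat.{max u v} R} {U : Set X} {p : ℕ} (f : (subsetCochains R N U).X p) :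
    (chainsInSub R R X U).toComplex.X p ⟶ N := f

open Classical in
/-- **Extension of a cochain of `W ∩ Y` to a cochain of `W`**, by zero on the simplices of `W` not
in `W ∩ Y` (the lift used in the snake lemma; Hatcher 2002, §2.2 p. 150 / §3.1 p. 204).
[cite: HatcherAT2002, §3.1 p. 204] -/
def extendLeft (f : (subsetCochains R 𝑹 (W ∩ Y)).X p) : (subsetCochains R 𝑹 W).X p :=
  show ((chainsInSub R R X W).toComplex.X p ⟶ 𝑹) from
    ModuleCat.ofHom ((asHom f).hom ∘ₗ Finsupp.restrictDom R R (simplicesIn X (W ∩ Y) p) ∘ₗ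
      (chainsIn R R X W p).subtype)

open Classical in
/-- `extendLeft f` on a `W`-small chain is `f` of its part in `W ∩ Y`. [folklore] -/
lemma extendLeft_apply (f : (subsetCochains R 𝑹 (W ∩ Y)).X p) (x : (chainsInSub R R X W).toComplex.X p) :
    asHom (extendLeft f) x = asHom f (Finsupp.restrictDom R R (simplicesIn X (W ∩ Y) p) x.1) := rfl

/-- **The function cochains of `f` and of `extendLeft f` agree** (both are `f` on the simplices of
`W ∩ Y` and `0` elsewhere). [folklore] -/
theorem toFun_extendLeft (f : (subsetCochains R 𝑹 (W ∩ Y)).X p) :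
    (SimplexSpan.ofSet (R := R) W).toFun (extendLeft f) =
      (SimplexSpan.ofSet (R := R) (W ∩ Y)).toFun f := by
  classical
  funext σ
  by_cases hW : σ.range ⊆ W
  · rw [(SimplexSpan.ofSet (R := R) W).toFun_apply_of_mem _ hW]
    change (asHom (extendLeft f) ⟨Finsupp.single σ 1, _⟩).down = _
    rw [extendLeft_apply]
    by_cases hWY : σ.range ⊆ W ∩ Y
    · rw [(SimplexSpan.ofSet (R := R) (W ∩ Y)).toFun_apply_of_mem _ hWY]
      congr 3
      apply Subtype.ext
      rw [Finsupp.restrictDom_apply, Finsupp.filter_single_of_pos _ ((mem_simplicesIn σ).mpr hWY)]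
    · rw [(SimplexSpan.ofSet (R := R) (W ∩ Y)).toFun_apply_of_not_mem _ hWY]
      have h0 : Finsupp.restrictDom R R (simplicesIn X (W ∩ Y) p) (Finsupp.single σ (1 : R)) = 0 := by
        apply Subtype.ext
        rw [Finsupp.restrictDom_apply,
          Finsupp.filter_single_of_neg _ (fun h => hWY ((mem_simplicesIn σ).mp h))]
        rfl
      rw [h0, map_zero]
      rfl
  · rw [(SimplexSpan.ofSet (R := R) W).toFun_apply_of_not_mem _ hW,
      (SimplexSpan.ofSet (R := R) (W ∩ Y)).toFun_apply_of_not_mem _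
        (fun h => hW (h.trans Set.inter_subset_left))]

/-- **`extendLeft f` restricts to `f` on `W ∩ Y`.** [folklore] -/
theorem res_extendLeft (f : (subsetCochains R 𝑹 (W ∩ Y)).X p) :
    (res R 𝑹 (Set.inter_subset_left : W ∩ Y ⊆ W)).f p (extendLeft f) = f := by
  classical
  rw [res_f_apply]
  change (Subcomplex.incl _).f p ≫ asHom (extendLeft f) = asHom f
  apply ModuleCat.hom_ext
  apply LinearMap.ext
  intro x
  have hx := LinearMap.congr_fun (Finsupp.restrictDom_comp_subtype (M := R) (R := R)
    (simplicesIn X (W ∩ Y) p)) x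
  rw [LinearMap.comp_apply, LinearMap.id_apply] at hx
  change asHom f (Finsupp.restrictDom R R (simplicesIn X (W ∩ Y) p) x.1) = asHom f x
  rw [show Finsupp.restrictDom R R (simplicesIn X (W ∩ Y) p) x.1 = x from hx]

open Classical in
/-- **The snake cochain** on the small chains `C(W) + C(Y)` attached to a `p`-cochain `f` of
`W ∩ Y`: the `(p+1)`-cochain which is `δ(extendLeft f)` on the `W`-part of a small chain (Hatcher
2002, §2.2 p. 150 / §3.1 p. 204: the cohomology Mayer–Vietoris connecting map).
[cite: HatcherAT2002, §3.1 p. 204] -/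
def snakeCochain (f : (subsetCochains R 𝑹 (W ∩ Y)).X p) :
    (dualObj R 𝑹 (chainsInSub R R X W ⊔ chainsInSub R R X Y).toComplex).X (p + 1) :=
  show ((chainsInSub R R X W ⊔ chainsInSub R R X Y).toComplex.X (p + 1) ⟶ 𝑹) from
    ModuleCat.ofHom ((asHom ((subsetCochains R 𝑹 W).d p (p + 1) (extendLeft f))).hom ∘ₗ
      Finsupp.restrictDom R R (simplicesIn X W (p + 1)) ∘ₗ
        ((chainsInSub R R X W ⊔ chainsInSub R R X Y) (p + 1)).subtype)

open Classical in
/-- `snakeCochain f` on a small chain is `δ(extendLeft f)` of its `W`-part. [folklore] -/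
lemma snakeCochain_apply (f : (subsetCochains R 𝑹 (W ∩ Y)).X p)
    (x : (chainsInSub R R X W ⊔ chainsInSub R R X Y).toComplex.X (p + 1)) :
    (show ((chainsInSub R R X W ⊔ chainsInSub R R X Y).toComplex.X (p + 1) ⟶ 𝑹) from snakeCochain f) x =
      asHom ((subsetCochains R 𝑹 W).d p (p + 1) (extendLeft f))
        (Finsupp.restrictDom R R (simplicesIn X W (p + 1)) x.1) := rfl

/-- **The snake cochain restricts to `δ(extendLeft f)` on `C(W)`.** [folklore] -/
theorem dualMap_left_snakeCochain (f : (subsetCochains R 𝑹 (W ∩ Y)).X p) :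
    (dualMap R 𝑹 (Subcomplex.incl (le_sup_left : chainsInSub R R X W ≤ chainsInSub R R X W ⊔ chainsInSub R R X Y))).f
        (p + 1) (snakeCochain f) =
      (subsetCochains R 𝑹 W).d p (p + 1) (extendLeft f) := by
  classical
  rw [dualMap_f_apply]
  change (Subcomplex.incl _).f (p + 1) ≫
    (show ((chainsInSub R R X W ⊔ chainsInSub R R X Y).toComplex.X (p + 1) ⟶ 𝑹) from snakeCochain f) = asHom _
  apply ModuleCat.hom_ext
  apply LinearMap.ext
  intro x
  have hx := LinearMap.congr_fun (Finsupp.restrictDom_comp_subtype (M := R) (R := R)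
    (simplicesIn X W (p + 1))) x
  rw [LinearMap.comp_apply, LinearMap.id_apply] at hx
  change asHom ((subsetCochains R 𝑹 W).d p (p + 1) (extendLeft f))
      (Finsupp.restrictDom R R (simplicesIn X W (p + 1)) x.1) =
    asHom ((subsetCochains R 𝑹 W).d p (p + 1) (extendLeft f)) x
  rw [show Finsupp.restrictDom R R (simplicesIn X W (p + 1)) x.1 = x from hx]

/-- The `W`-part of a `Y`-small chain is a `W ∩ Y`-small chain. [folklore] -/
lemma restrictDom_mem_chainsIn_inter [DecidablePred (· ∈ simplicesIn X W (p + 1))]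
    (x : CChain R X (p + 1)) (hx : x ∈ chainsIn R R X Y (p + 1)) :
    (Finsupp.restrictDom R R (simplicesIn X W (p + 1)) x).1 ∈ chainsIn R R X (W ∩ Y) (p + 1) := by
  rw [mem_chainsIn_iff]
  intro σ hσ
  rw [Finsupp.restrictDom_apply, Finsupp.support_filter, Finset.mem_filter] at hσ
  exact Set.subset_inter ((mem_simplicesIn σ).mp hσ.2) ((mem_chainsIn_iff R R x).mp hx σ hσ.1)

/-- **The snake cochain restricts to `0` on `C(Y)` when `f` is a cocycle**: on a `Y`-small chain
`x`, `δ(extendLeft f)(x|W) = f(∂(x|W)) = (δf)(x|W) = 0` as `x|W` is `W ∩ Y`-small. [folklore] -/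
theorem dualMap_right_snakeCochain (f : (subsetCochains R 𝑹 (W ∩ Y)).X p)
    (hf : (subsetCochains R 𝑹 (W ∩ Y)).d p (p + 1) f = 0) :
    (dualMap R 𝑹 (Subcomplex.incl (le_sup_right : chainsInSub R R X Y ≤ chainsInSub R R X W ⊔ chainsInSub R R X Y))).f
        (p + 1) (snakeCochain f) = 0 := by
  classical
  rw [dualMap_f_apply]
  change (Subcomplex.incl _).f (p + 1) ≫
    (show ((chainsInSub R R X W ⊔ chainsInSub R R X Y).toComplex.X (p + 1) ⟶ 𝑹) from snakeCochain f) = 0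
  apply ModuleCat.hom_ext
  apply LinearMap.ext
  intro x
  rw [ModuleCat.hom_comp, LinearMap.comp_apply]
  change (show ((chainsInSub R R X W ⊔ chainsInSub R R X Y).toComplex.X (p + 1) ⟶ 𝑹) from snakeCochain f)
    ((Subcomplex.incl (le_sup_right : chainsInSub R R X Y ≤ chainsInSub R R X W ⊔ chainsInSub R R X Y)).f
      (p + 1) x) = 0
  rw [snakeCochain_apply]
  set u : (chainsInSub R R X (W ∩ Y)).toComplex.X (p + 1) :=
    ⟨(Finsupp.restrictDom R R (simplicesIn X W (p + 1)) x.1).1, restrictDom_mem_chainsIn_inter x.1 x.2⟩ with hu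
  have e1 : (Finsupp.restrictDom R R (simplicesIn X W (p + 1))
      ((Subcomplex.incl (le_sup_right : chainsInSub R R X Y ≤ chainsInSub R R X W ⊔ chainsInSub R R X Y)).f
        (p + 1) x).1 : (chainsInSub R R X W).toComplex.X (p + 1)) =
      (Subcomplex.incl (chainsInSub_mono R R (Set.inter_subset_left : W ∩ Y ⊆ W))).f (p + 1) u := by
    apply Subtype.ext
    rfl
  rw [e1]
  change ((Subcomplex.incl (chainsInSub_mono R R (Set.inter_subset_left : W ∩ Y ⊆ W))).f (p + 1) ≫
    asHom ((subsetCochains R 𝑹 W).d p (p + 1) (extendLeft f))) u = 0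
  rw [← dualMap_f_apply]
  change asHom ((res R 𝑹 (Set.inter_subset_left : W ∩ Y ⊆ W)).f (p + 1)
    ((subsetCochains R 𝑹 W).d p (p + 1) (extendLeft f))) u = 0
  have hcomm := ConcreteCategory.congr_hom
    ((res R 𝑹 (Set.inter_subset_left : W ∩ Y ⊆ W)).comm p (p + 1)) (extendLeft f)
  rw [ModuleCat.comp_apply, ModuleCat.comp_apply, res_extendLeft] at hcomm
  rw [← hcomm, hf]
  rfl

/-- `F(ψ) = d(g, 0)` for the snake cochain `ψ` and the lift `(g, 0)`, `g = extendLeft f`, of a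
cocycle `f`, in the Mayer–Vietoris short complex of cochains. [folklore] -/
lemma mvShortComplex_f_snakeCochain (f : (subsetCochains R 𝑹 (W ∩ Y)).X p)
    (hf : (subsetCochains R 𝑹 (W ∩ Y)).d p (p + 1) f = 0) :
    (mvShortComplex R 𝑹 W Y).f.f (p + 1) (snakeCochain f) =
      (subsetCochains R 𝑹 W ⊞ subsetCochains R 𝑹 Y).d p (p + 1)
        ((biprod.inl : _ ⟶ subsetCochains R 𝑹 W ⊞ subsetCochains R 𝑹 Y).f p (extendLeft f)) := by
  have hcomm : (subsetCochains R 𝑹 W ⊞ subsetCochains R 𝑹 Y).d p (p + 1)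
      ((biprod.inl : _ ⟶ subsetCochains R 𝑹 W ⊞ subsetCochains R 𝑹 Y).f p (extendLeft f)) =
      (biprod.inl : _ ⟶ subsetCochains R 𝑹 W ⊞ subsetCochains R 𝑹 Y).f (p + 1)
        ((subsetCochains R 𝑹 W).d p (p + 1) (extendLeft f)) := by
    rw [← ModuleCat.comp_apply, (biprod.inl : _ ⟶ subsetCochains R 𝑹 W ⊞ subsetCochains R 𝑹 Y).comm,
      ModuleCat.comp_apply]
  rw [hcomm]
  change (biprod.lift (dualMap R 𝑹 (Subcomplex.incl (le_sup_left : chainsInSub R R X W ≤ _)))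
    (dualMap R 𝑹 (Subcomplex.incl (le_sup_right : chainsInSub R R X Y ≤ _)))).f (p + 1) (snakeCochain f) = _
  rw [biprod.lift_eq, HomologicalComplex.add_f_apply]
  change (dualMap R 𝑹 (Subcomplex.incl le_sup_left) ≫ biprod.inl).f (p + 1) (snakeCochain f) +
    (dualMap R 𝑹 (Subcomplex.incl le_sup_right) ≫ biprod.inr).f (p + 1) (snakeCochain f) = _
  rw [HomologicalComplex.comp_f, HomologicalComplex.comp_f, ModuleCat.comp_apply, ModuleCat.comp_apply,
    dualMap_left_snakeCochain, dualMap_right_snakeCochain f hf, map_zero, add_zero]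

/-- The snake cochain of a cocycle is a cocycle. [folklore] -/
theorem d_snakeCochain (f : (subsetCochains R 𝑹 (W ∩ Y)).X p)
    (hf : (subsetCochains R 𝑹 (W ∩ Y)).d p (p + 1) f = 0) (k : ℕ) :
    (dualObj R 𝑹 (chainsInSub R R X W ⊔ chainsInSub R R X Y).toComplex).d (p + 1) k (snakeCochain f) = 0 :=
  ShortComplex.d_eq_zero_of_f_eq_d (mvShortComplex_shortExact R 𝑹 W Y)
    ((biprod.inl : _ ⟶ subsetCochains R 𝑹 W ⊞ subsetCochains R 𝑹 Y).f p (extendLeft f)) (snakeCochain f)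
    (mvShortComplex_f_snakeCochain f hf)

/-- **The cohomology Mayer–Vietoris connecting map on representatives**: for a cocycle `f` of
`Hom(C(W ∩ Y), 𝑹)`, the connecting map of `0 → Hom(C(W) + C(Y)) → Hom(C(W)) ⊞ Hom(C(Y)) →
Hom(C(W ∩ Y)) → 0` sends `[f]` to the class of the snake cochain (Hatcher 2002, §2.2 p. 150,
§3.1 p. 204). [cite: HatcherAT2002, §3.1 p. 204] -/
theorem shortExact_δ_cls (W Y : Set X) (f : (subsetCochains R 𝑹 (W ∩ Y)).X p)
    (hf' : (subsetCochains R 𝑹 (W ∩ Y)).d p ((ComplexShape.down ℕ).symm.next p) f = 0) :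
    (mvShortComplex_shortExact R 𝑹 W Y).δ p (p + 1) (crel p) (homologyCls f hf') =
      homologyCls (K := dualObj R 𝑹 (chainsInSub R R X W ⊔ chainsInSub R R X Y).toComplex) (snakeCochain f)
        (d_snakeCochain f ((d_next_eq_zero_iff (SimplexSpan.symm_down_next p) f).mp hf') _) := by
  have hf : (subsetCochains R 𝑹 (W ∩ Y)).d p (p + 1) f = 0 :=
    (d_next_eq_zero_iff (SimplexSpan.symm_down_next p) f).mp hf'
  have key := (mvShortComplex_shortExact R 𝑹 W Y).δ_apply p (p + 1) (crel p) f hf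
    ((biprod.inl : _ ⟶ subsetCochains R 𝑹 W ⊞ subsetCochains R 𝑹 Y).f p (extendLeft f))
    (by
      change (biprod.desc (res R 𝑹 Set.inter_subset_left) (-res R 𝑹 Set.inter_subset_right)).f p
        ((biprod.inl : _ ⟶ subsetCochains R 𝑹 W ⊞ subsetCochains R 𝑹 Y).f p (extendLeft f)) = f
      rw [← ModuleCat.comp_apply, ← HomologicalComplex.comp_f, biprod.inl_desc, res_extendLeft])
    (snakeCochain f) (mvShortComplex_f_snakeCochain f hf) ((ComplexShape.down ℕ).symm.next (p + 1)) rfl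
  rw [homologyCls_eq_homologyπ_cyclesMk _ _ (p + 1) (SimplexSpan.symm_down_next p),
    homologyCls_eq_homologyπ_cyclesMk _ _ ((ComplexShape.down ℕ).symm.next (p + 1)) rfl]
  exact key

/-- **Restricting the Mayer–Vietoris connecting map to small cochains**:
`(mvδ [f])|_{C(W)+C(Y)} = [snakeCochain f]` (`mvδ` is the connecting map followed by the inverse of
the restriction isomorphism to small cochains). [folklore] -/
theorem homologyMap_resSup_mvδ {W Y : Set X} (hW : IsOpen W) (hY : IsOpen Y)
    (f : (subsetCochains R 𝑹 (W ∩ Y)).X p)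
    (hf' : (subsetCochains R 𝑹 (W ∩ Y)).d p ((ComplexShape.down ℕ).symm.next p) f = 0) :
    HomologicalComplex.homologyMap (resSup R 𝑹 W Y) (p + 1) (mvδ R 𝑹 hW hY p (homologyCls f hf')) =
      homologyCls (K := dualObj R 𝑹 (chainsInSub R R X W ⊔ chainsInSub R R X Y).toComplex) (snakeCochain f)
        (d_snakeCochain f ((d_next_eq_zero_iff (SimplexSpan.symm_down_next p) f).mp hf') _) := by
  change ((mvShortComplex_shortExact R 𝑹 W Y).δ p (p + 1) (crel p) ≫
    (supHomologyIso (N := 𝑹) hW hY (p + 1)).hom ≫ (supHomologyIso (N := 𝑹) hW hY (p + 1)).inv) (homologyCls f hf') = _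
  rw [Iso.hom_inv_id, Category.comp_id, shortExact_δ_cls]

end Snake

end subsetCochains

/-! ### The third square of the ladder: `(δb) ⌢ x = ± ∂(b ⌢ x|)` -/

namespace CechDuality

variable {R : Type v} [CommRing R] {X : Type u} [TopologicalSpace X]

/-- Local notation: the coefficient object `ULift R` of `ModuleCat.{max u v} R` (`CechCapProduct.lean`). -/
local notation "𝑹" => SimplexSpan.coefR R

/-- The binary open cover `{W, Y}` as a `Bool`-indexed family. [folklore] -/
def pairCover (W Y : Set X) : Bool → Set X := fun b => cond b W Y

omit [TopologicalSpace X] in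
/-- `pairCover W Y true = W`. [folklore] -/
@[simp] lemma pairCover_true (W Y : Set X) : pairCover W Y true = W := rfl

omit [TopologicalSpace X] in
/-- `pairCover W Y false = Y`. [folklore] -/
@[simp] lemma pairCover_false (W Y : Set X) : pairCover W Y false = Y := rfl

/-- **The third square of Miller's ladder (Thm. 36.2), "`(δb) ⌢ x_{A∪B} = ∂(b ⌢ x_{A∩B})`"
(p. 119), up to the sign `(-1)^{p+1}`**: for compact `A`, `B` in a Hausdorff space,
`x ∈ Hₙ(X | A ∪ B)` and `b ∈ Ȟ^p(A ∩ B)`,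
`(δb) ⌢ x = (-1)^{p+1} ∂(b ⌢ x|_{A ∩ B})` in `H_{q'}(X | A ∪ B)`, `p + q' + 1 = n`.
Proof on representatives adapted to a pair of neighbourhoods (`exists_coverRep`), with the
snake cochain (`subsetCochains.homologyMap_resSup_mvδ`) on the cohomology side — the Čech cap
product of `A ∪ B` is moved to the small cochains `Hom(C(W) + C(Y))` by `SimplexSpan.capH_dualMap`
— and `clocalHomology.mvδ_relCls` on the homology side. [cite: Miller2020, Thm. 36.2] -/
theorem cechCap_mvδ [T2Space X] {A B : Set X} (hA : IsCompact A) (hB : IsCompact B) {p q' : ℕ}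
    (μ : clocalHomology R R X (A ∪ B) (p + q' + 1)) (b : Cech R 𝑹 (A ∩ B) p) :
    cechCap (hA.union hB).isClosed (show (p + 1) + q' = p + q' + 1 by omega) μ
        (Cech.mvδ (N := 𝑹) hA hB p b) =
      (-1 : R) ^ (p + 1) • clocalHomology.mvδ R R hA.isClosed hB.isClosed q'
        (cechCap (hA.inter hB).isClosed (show p + (q' + 1) = p + q' + 1 by omega)
          (clocalHomology.res R R X (Set.inter_subset_left.trans Set.subset_union_left : A ∩ B ⊆ A ∪ B)
            (p + q' + 1) μ) b) := by
  -- Step 0: `b` comes from `H^p_X(W ∩ Y)` for neighbourhoods `W ⊇ A`, `Y ⊇ B`, as the class of a cocycle `f`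
  obtain ⟨N₀, e₀, rfl⟩ := Cech.exists_of b
  obtain ⟨W, Y, hN₀⟩ := OpenNhd.exists_inter₂_le hA hB N₀
  rw [← Cech.of_res hN₀ e₀]
  obtain ⟨f, hf', hfe⟩ := homologyCls_surjective (subsetCochains.resH hN₀ p e₀)
  rw [← hfe]
  have hf : (subsetCochains R 𝑹 (W.carrier ∩ Y.carrier)).d p (p + 1) f = 0 :=
    (d_next_eq_zero_iff (SimplexSpan.symm_down_next p) f).mp hf'
  have hAc : IsClosed A := hA.isClosed
  have hBc : IsClosed B := hB.isClosed
  -- the function cochain `G` of `f` is a cocycle on `W ∩ Y`-small simplices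
  have hG : IsCocycleOn (fun _ : Unit => W.carrier ∩ Y.carrier)
      ((SimplexSpan.ofSet (R := R) (W.carrier ∩ Y.carrier)).toFun f) :=
    (SimplexSpan.ofSet (R := R) (W.carrier ∩ Y.carrier)).isCocycleOn_toFun (fun _ _ _ hσ => hσ) f hf
  -- Step 1: an adapted representative `z = z₁ + z₂ + z₃` of `μ`
  obtain ⟨z₁, z₂, z₃, hz₁, hz₂, hz₃, hz, hzμ⟩ :=
    exists_coverRep (R := R) (M := R) W.isOpen Y.isOpen hAc hBc W.subset Y.subset μ
  have h₁ : (p + 1) + q' = p + q' + 1 := by omega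
  have h₂ : p + q' = p + q' := rfl
  have h₃ : p + (q' + 1) = p + q' + 1 := by omega
  have hz12W : z₁ + z₂ ∈ chainsIn R R X W.carrier (p + q' + 1) :=
    Submodule.add_mem _ (chainsIn_mono R R Set.inter_subset_left _ hz₁)
      (chainsIn_mono R R Set.inter_subset_left _ hz₂)
  have hz₃Y : z₃ ∈ chainsIn R R X Y.carrier (p + q' + 1) := chainsIn_mono R R Set.inter_subset_left _ hz₃
  have hzsmall : z₁ + z₂ + z₃ ∈ smallChains R R X (pairCover W.carrier Y.carrier) (p + q' + 1) :=
    Submodule.add_mem _ (chainsIn_le_smallChains R R (pairCover W.carrier Y.carrier) true _ hz12W)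
      (chainsIn_le_smallChains R R (pairCover W.carrier Y.carrier) false _ hz₃Y)
  have hz₁small : z₁ ∈ smallChains R R X (fun _ : Unit => W.carrier ∩ Y.carrier) (p + q' + 1) :=
    chainsIn_le_smallChains R R (fun _ : Unit => W.carrier ∩ Y.carrier) () _ hz₁
  have hz12Wsmall : z₁ + z₂ ∈ smallChains R R X (fun _ : Unit => W.carrier) (p + q' + 1) :=
    chainsIn_le_smallChains R R (fun _ : Unit => W.carrier) () _ hz12W
  have hz₃Ysmall : z₃ ∈ smallChains R R X (fun _ : Unit => Y.carrier) (p + q' + 1) :=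
    chainsIn_le_smallChains R R (fun _ : Unit => Y.carrier) () _ hz₃Y
  -- boundaries of the pieces
  have hdz : (csingularChainComplex R R X).d (p + q' + 1) (p + q') (z₁ + z₂ + z₃) ∈ awaySub R R X (A ∪ B) (p + q') := by
    have h := hz
    rw [ChainComplex.next_nat_succ] at h
    exact h
  have hdz₂ : (csingularChainComplex R R X).d (p + q' + 1) (p + q') z₂ ∈ chainsIn R R X (W.carrier ∩ Bᶜ) (p + q') :=
    (chainsInSub R R X (W.carrier ∩ Bᶜ)).d_mem hz₂
  have hdz₃ : (csingularChainComplex R R X).d (p + q' + 1) (p + q') z₃ ∈ chainsIn R R X (Y.carrier ∩ Aᶜ) (p + q') :=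
    (chainsInSub R R X (Y.carrier ∩ Aᶜ)).d_mem hz₃
  have hWB : W.carrier ∩ Bᶜ ⊆ (A ∩ B)ᶜ := fun x hx hx' => hx.2 hx'.2
  have hYA : Y.carrier ∩ Aᶜ ⊆ (A ∩ B)ᶜ := fun x hx hx' => hx.2 hx'.1
  have hz₂₃ : z₂ + z₃ ∈ awaySub R R X (A ∩ B) (p + q' + 1) :=
    Submodule.add_mem _ (chainsIn_mono R R hWB _ hz₂) (chainsIn_mono R R hYA _ hz₃)
  have ez₁ : z₁ = (z₁ + z₂ + z₃) - z₂ - z₃ := by abel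
  have hdz₁ : (csingularChainComplex R R X).d (p + q' + 1) (p + q') z₁ ∈ awaySub R R X (A ∩ B) (p + q') := by
    rw [ez₁, map_sub, map_sub]
    exact Submodule.sub_mem _ (Submodule.sub_mem _
      (clocalHomology.awaySub_mono R R (Set.inter_subset_left.trans Set.subset_union_left) _ hdz)
      (chainsIn_mono R R hWB _ hdz₂)) (chainsIn_mono R R hYA _ hdz₃)
  have hz₁K : (csingularChainComplex R R X).d (p + q' + 1) ((ComplexShape.down ℕ).next (p + q' + 1)) z₁ ∈
      awaySub R R X (A ∩ B) ((ComplexShape.down ℕ).next (p + q' + 1)) := by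
    rw [ChainComplex.next_nat_succ]
    exact hdz₁
  have hμ₁ : (awaySub R R X (A ∩ B)).relCls z₁ hz₁K =
      clocalHomology.res R R X (Set.inter_subset_left.trans Set.subset_union_left : A ∩ B ⊆ A ∪ B)
        (p + q' + 1) μ := by
    rw [← hzμ, clocalHomology.res_eq, Subcomplex.homologyMap_quotientMap_relCls]
    refine Subcomplex.relCls_eq_relCls_of_prev (ChainComplex.prev (α := ℕ) (p + q' + 1)) _ _ _ _ 0 ?_
    rw [map_zero, zero_sub, show -(z₁ - (z₁ + z₂ + z₃)) = z₂ + z₃ by abel]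
    exact hz₂₃
  -- Step 2: the left-hand side, moved to small cochains and computed on `z`
  have hWYo : ∀ b', IsOpen (pairCover W.carrier Y.carrier b') := fun b' => by
    cases b'
    · exact Y.isOpen
    · exact W.isOpen
  have hKWY : A ∪ B ⊆ ⋃ b', pairCover W.carrier Y.carrier b' := by
    rintro x (hx | hx)
    · exact Set.mem_iUnion.mpr ⟨true, W.subset hx⟩
    · exact Set.mem_iUnion.mpr ⟨false, Y.subset hx⟩
  have hWY' : ∀ b' k (σ : SingularSimplex X k), σ.range ⊆ pairCover W.carrier Y.carrier b' →
      σ ∈ (SimplexSpan.ofSets (R := R) W.carrier Y.carrier).carrier k := fun b' k σ hσ => by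
    cases b'
    · exact Or.inr hσ
    · exact Or.inl hσ
  have hWW : ∀ b', ∃ _ : Unit, pairCover W.carrier Y.carrier b' ⊆ (OpenNhd.union W Y).carrier :=
    fun b' => ⟨(), by
      cases b'
      · exact Set.subset_union_right
      · exact Set.subset_union_left⟩
  rw [Cech.mvδ_of hA hB W Y (homologyCls f hf'), cechCap_of]
  change (SimplexSpan.ofSet (R := R) (OpenNhd.union W Y).carrier).capH (W := fun _ : Unit => (OpenNhd.union W Y).carrier)
    (hA.union hB).isClosed (fun _ => (OpenNhd.union W Y).isOpen)
    (fun _ hx => Set.mem_iUnion.mpr ⟨(), (OpenNhd.union W Y).subset hx⟩) (fun _ _ _ hσ => hσ) h₁ μ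
    (subsetCochains.mvδ R 𝑹 W.isOpen Y.isOpen p (homologyCls f hf')) = _
  rw [← (SimplexSpan.ofSet (R := R) (OpenNhd.union W Y).carrier).capH_dualMap (hA.union hB).isClosed
      _ _ _ (SimplexSpan.ofSets (R := R) W.carrier Y.carrier) hWYo hKWY hWY'
      (chainsInSub_sup_le R R W.carrier Y.carrier) hWW h₁ μ]
  change (SimplexSpan.ofSets (R := R) W.carrier Y.carrier).capH (hA.union hB).isClosed hWYo hKWY hWY' h₁ μ
    (HomologicalComplex.homologyMap (subsetCochains.resSup R 𝑹 W.carrier Y.carrier) (p + 1)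
      (subsetCochains.mvδ R 𝑹 W.isOpen Y.isOpen p (homologyCls f hf'))) = _
  have hψ' : IsCocycleOn (pairCover W.carrier Y.carrier)
      ((SimplexSpan.ofSets (R := R) W.carrier Y.carrier).toFun (subsetCochains.snakeCochain f)) :=
    (SimplexSpan.ofSets (R := R) W.carrier Y.carrier).isCocycleOn_toFun hWY' _
      (subsetCochains.d_snakeCochain f hf _)
  rw [subsetCochains.homologyMap_resSup_mvδ W.isOpen Y.isOpen f hf',
    (SimplexSpan.ofSets (R := R) W.carrier Y.carrier).capH_homologyCls (hA.union hB).isClosed hWYo hKWY hWY' h₁ μ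
      (subsetCochains.snakeCochain f) _ hψ',
    clocalHomology.capLoc_eq_capSmall (hA.union hB).isClosed hWYo hKWY h₁ hψ' (z₁ + z₂ + z₃) hzsmall hz hzμ]
  -- Step 3: the right-hand side on the representative `z₁`
  rw [cechCap_of, capOpen_homologyCls (hA.inter hB).isClosed h₃ _ (OpenNhd.inter₂ W Y) f hf' hG,
    clocalHomology.capLoc_eq_capSmall (hA.inter hB).isClosed _ _ h₃ hG z₁ hz₁small hz₁K hμ₁]
  unfold clocalHomology.capSmall
  -- Step 4: the homology connecting map on `[z₁ ⌢ G]`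
  have hT1B : ccapChain R h₂ ((SimplexSpan.ofSet (R := R) (W.carrier ∩ Y.carrier)).toFun f)
      ((csingularChainComplex R R X).d (p + q' + 1) (p + q') z₂) ∈ awaySub R R X B q' :=
    ccapChain_mem_chainsIn h₂ _ (chainsIn_mono R R (fun x hx => hx.2) _ hdz₂)
  have hb₀B : (-1 : R) ^ (p + 1) • ccapChain R h₂ ((SimplexSpan.ofSet (R := R) (W.carrier ∩ Y.carrier)).toFun f)
      ((csingularChainComplex R R X).d (p + q' + 1) (p + q') z₂) ∈ awaySub R R X B q' := Submodule.smul_mem _ _ hT1B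
  have ha : (csingularChainComplex R R X).d (q' + 1) q' (ccapChain R h₃ ((SimplexSpan.ofSet (R := R) (W.carrier ∩ Y.carrier)).toFun f) z₁) -
      (-1 : R) ^ (p + 1) • ccapChain R h₂ ((SimplexSpan.ofSet (R := R) (W.carrier ∩ Y.carrier)).toFun f)
        ((csingularChainComplex R R X).d (p + q' + 1) (p + q') z₂) ∈ awaySub R R X A q' := by
    rw [d_ccapChain_of_isCocycleOn h₂ hG hz₁small, ez₁, map_sub, map_sub, map_sub, map_sub,
      show ∀ (T0 T1 T3 : (csingularChainComplex R R X).X q'), (-1 : R) ^ p • (T0 - T1 - T3) - (-1 : R) ^ (p + 1) • T1 =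
        (-1 : R) ^ p • (T0 - T3) from fun T0 T1 T3 => by rw [pow_succ]; module]
    exact Submodule.smul_mem _ _ (Submodule.sub_mem _
      (ccapChain_mem_chainsIn h₂ _ (clocalHomology.awaySub_mono R R Set.subset_union_left _ hdz))
      (ccapChain_mem_chainsIn h₂ _ (chainsIn_mono R R (fun x hx => hx.2) _ hdz₃)))
  have hz' : (csingularChainComplex R R X).d (q' + 1) ((ComplexShape.down ℕ).next (q' + 1))
      (ccapChain R h₃ ((SimplexSpan.ofSet (R := R) (W.carrier ∩ Y.carrier)).toFun f) z₁) ∈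
        awaySub R R X (A ∩ B) ((ComplexShape.down ℕ).next (q' + 1)) :=
    d_ccapChain_mem_awaySub (A ∩ B) h₃ hG hz₁small hz₁K
  have hb₀' : (csingularChainComplex R R X).d q' ((ComplexShape.down ℕ).next q')
      ((-1 : R) ^ (p + 1) • ccapChain R h₂ ((SimplexSpan.ofSet (R := R) (W.carrier ∩ Y.carrier)).toFun f)
        ((csingularChainComplex R R X).d (p + q' + 1) (p + q') z₂)) ∈ awaySub R R X (A ∪ B) ((ComplexShape.down ℕ).next q') := by
    rw [clocalHomology.awaySub_union]
    refine ⟨?_, (awaySub R R X B).d_mem hb₀B⟩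
    rw [show (-1 : R) ^ (p + 1) • ccapChain R h₂ ((SimplexSpan.ofSet (R := R) (W.carrier ∩ Y.carrier)).toFun f)
        ((csingularChainComplex R R X).d (p + q' + 1) (p + q') z₂) =
      (csingularChainComplex R R X).d (q' + 1) q' (ccapChain R h₃ ((SimplexSpan.ofSet (R := R) (W.carrier ∩ Y.carrier)).toFun f) z₁) -
        ((csingularChainComplex R R X).d (q' + 1) q' (ccapChain R h₃ ((SimplexSpan.ofSet (R := R) (W.carrier ∩ Y.carrier)).toFun f) z₁) -
          (-1 : R) ^ (p + 1) • ccapChain R h₂ ((SimplexSpan.ofSet (R := R) (W.carrier ∩ Y.carrier)).toFun f)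
            ((csingularChainComplex R R X).d (p + q' + 1) (p + q') z₂)) by abel,
      map_sub, ← ModuleCat.comp_apply, (csingularChainComplex R R X).d_comp_d]
    exact Submodule.sub_mem _ (by exact Submodule.zero_mem _) ((awaySub R R X A).d_mem ha)
  rw [clocalHomology.mvδ_relCls R R hAc hBc q'
      (ccapChain R h₃ ((SimplexSpan.ofSet (R := R) (W.carrier ∩ Y.carrier)).toFun f) z₁) _ hb₀B ha hz' hb₀',
    ← Subcomplex.relCls_smul _ ((-1 : R) ^ (p + 1)) _ hb₀' (by
      rw [map_smul]; exact Submodule.smul_mem _ _ hb₀')]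
  have hT1 : (csingularChainComplex R R X).d q' ((ComplexShape.down ℕ).next q')
      (ccapChain R h₂ ((SimplexSpan.ofSet (R := R) (W.carrier ∩ Y.carrier)).toFun f)
        ((csingularChainComplex R R X).d (p + q' + 1) (p + q') z₂)) ∈ awaySub R R X (A ∪ B) ((ComplexShape.down ℕ).next q') := by
    have h := hb₀'
    rw [map_smul] at h
    have h2 := Submodule.smul_mem _ ((-1 : R) ^ (p + 1)) h
    rw [neg_one_pow_smul_neg_one_pow_smul] at h2
    exact h2
  rw [Subcomplex.relCls_congr _ (neg_one_pow_smul_neg_one_pow_smul (p + 1) _) _ hT1]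
  -- Step 5: the representative of the left-hand side is `z₂ ⌢ δG`
  have hr₀ : ccapChain R h₁ ((SimplexSpan.ofSets (R := R) W.carrier Y.carrier).toFun (subsetCochains.snakeCochain f))
        (z₁ + z₂ + z₃) =
      ccapChain R h₁ ((singularCochainComplex R R X).d p (p + 1)
        ((SimplexSpan.ofSet (R := R) (W.carrier ∩ Y.carrier)).toFun f)) z₂ := by
    rw [map_add,
      ccapChain_congr_of_small h₁ _
        ((SimplexSpan.ofSet (R := R) W.carrier).toFun
          ((subsetCochains R 𝑹 W.carrier).d p (p + 1) (subsetCochains.extendLeft f)))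
        (fun σ hσ => by
          obtain ⟨_, hσ⟩ := hσ
          have e : (Subcomplex.incl (le_sup_left :
              (SimplexSpan.ofSet (R := R) W.carrier).sub ≤ (SimplexSpan.ofSets (R := R) W.carrier Y.carrier).sub)).f
                (p + 1) ≫ subsetCochains.snakeCochain f =
              (subsetCochains R 𝑹 W.carrier).d p (p + 1) (subsetCochains.extendLeft f) :=
            subsetCochains.dualMap_left_snakeCochain f
          rw [← (SimplexSpan.ofSets (R := R) W.carrier Y.carrier).toFun_incl (SimplexSpan.ofSet (R := R) W.carrier)
              le_sup_left (subsetCochains.snakeCochain f) hσ (Or.inl hσ), e]) hz12Wsmall,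
      ccapChain_congr_of_small h₁ _ (0 : SingularSimplex X (p + 1) → R)
        (fun σ hσ => by
          obtain ⟨_, hσ⟩ := hσ
          have e : (Subcomplex.incl (le_sup_right :
              (SimplexSpan.ofSet (R := R) Y.carrier).sub ≤ (SimplexSpan.ofSets (R := R) W.carrier Y.carrier).sub)).f
                (p + 1) ≫ subsetCochains.snakeCochain f = 0 :=
            subsetCochains.dualMap_right_snakeCochain f hf
          rw [← (SimplexSpan.ofSets (R := R) W.carrier Y.carrier).toFun_incl (SimplexSpan.ofSet (R := R) Y.carrier)
              le_sup_right (subsetCochains.snakeCochain f) hσ (Or.inr hσ), e, SimplexSpan.toFun_zero]) hz₃Ysmall,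
      ccapChain_zero,
      ccapChain_congr_of_small h₁ _ _
        (fun σ hσ => by
          obtain ⟨_, hσ⟩ := hσ
          exact (SimplexSpan.ofSet (R := R) W.carrier).toFun_d (subsetCochains.extendLeft f) hσ) hz12Wsmall,
      subsetCochains.toFun_extendLeft, map_add,
      ccapChain_eq_zero_of_forall_small h₁ _ (fun σ hσ => hG σ hσ) hz₁small, zero_add,
      show ((0 : (csingularChainComplex R R X).X (p + q' + 1) ⟶ (csingularChainComplex R R X).X q') z₃) = 0 from rfl, add_zero]
  -- Step 6: the bounding chain `-(-1)ᵖ (z₂ ⌢ G)`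
  refine Subcomplex.relCls_eq_relCls_of_prev (ChainComplex.prev (α := ℕ) q') _ _ _ hT1
    (-((-1 : R) ^ p • ccapChain R h₃ ((SimplexSpan.ofSet (R := R) (W.carrier ∩ Y.carrier)).toFun f) z₂)) ?_
  rw [map_neg, map_smul, d_ccapChain_apply h₂ _ z₂, neg_one_pow_smul_neg_one_pow_smul, hr₀,
    show ∀ (T1 T2 : (csingularChainComplex R R X).X q'), -(T1 - T2) - (T2 - T1) = 0 from fun T1 T2 => by abel]
  exact Submodule.zero_mem _

end CechDuality

/-! ### Degree zero: `H⁰_X(A ∪ B) → H⁰_X(A) × H⁰_X(B)` and `Ȟ⁰(A ∪ B) → Ȟ⁰(A) × Ȟ⁰(B)` are injective -/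

namespace subsetCochains

variable {R : Type v} [CommRing R] {X : Type u} [TopologicalSpace X] {N : ModuleCat.{max u v} R}

omit [TopologicalSpace X] in
/-- The image of a singular `0`-simplex is a single point. [folklore] -/
lemma range_eq_singleton_pt [TopologicalSpace X] (ρ : SingularSimplex X 0) : ρ.range = {ρ.pt} := by
  ext y
  constructor
  · rintro ⟨t, rfl⟩
    rw [Set.mem_singleton_iff, SingularSimplex.pt, Subsingleton.elim (α := stdSimplex ℝ (Fin 1)) t default]
  · rintro rfl
    exact SingularSimplex.pt_mem_range ρ

/-- `C₀(A ∪ B) ≤ C₀(A) + C₀(B)`: a `0`-simplex of `A ∪ B` lies in `A` or in `B`. [folklore] -/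
lemma chainsIn_union_zero_le {M' : Type v} [AddCommGroup M'] [Module R M'] (A B : Set X) :
    chainsIn R M' X (A ∪ B) 0 ≤ chainsIn R M' X A 0 ⊔ chainsIn R M' X B 0 := by
  have hsub : simplicesIn X (A ∪ B) 0 ⊆ simplicesIn X A 0 ∪ simplicesIn X B 0 := by
    intro ρ hρ
    rw [mem_simplicesIn, range_eq_singleton_pt, Set.singleton_subset_iff] at hρ
    rcases hρ with h | h
    · exact Or.inl ((mem_simplicesIn ρ).mpr (by rw [range_eq_singleton_pt, Set.singleton_subset_iff]; exact h))
    · exact Or.inr ((mem_simplicesIn ρ).mpr (by rw [range_eq_singleton_pt, Set.singleton_subset_iff]; exact h))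
  intro c hc
  have h := Finsupp.supported_mono (M := M') (R := R) hsub hc
  rw [Finsupp.supported_union] at h
  exact h

/-- In degree `0` a class which restricts to zero is represented by the zero cocycle restricted:
`(res g) = 0` as a cochain (there are no coboundaries in degree `0`). [folklore] -/
lemma res_f_zero_eq_zero_of_resH {A' B' : Set X} (h : A' ⊆ B') (g : (subsetCochains R N B').X 0)
    (hg : (subsetCochains R N B').d 0 ((ComplexShape.down ℕ).symm.next 0) g = 0)
    (h0 : resH h 0 (homologyCls g hg) = 0) : (res R N h).f 0 g = 0 := by
  change HomologicalComplex.homologyMap (res R N h) 0 (homologyCls g hg) = 0 at h0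
  rw [homologyMap_homologyCls, homologyCls_eq_zero_iff] at h0
  obtain ⟨w, hw⟩ := h0
  rw [← hw, (subsetCochains R N A').shape _ _ (fun hr => Nat.succ_ne_zero _ hr)]
  rfl

/-- **`H⁰_X(A ∪ B) → H⁰_X(A) × H⁰_X(B)` is injective** (for arbitrary subsets; a `0`-cocycle
vanishing on the points of `A` and of `B` vanishes). [folklore] -/
theorem homologyCls_zero_eq_zero {A B : Set X} (g : (subsetCochains R N (A ∪ B)).X 0)
    (hg : (subsetCochains R N (A ∪ B)).d 0 ((ComplexShape.down ℕ).symm.next 0) g = 0)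
    (ha : resH Set.subset_union_left 0 (homologyCls g hg) = 0)
    (hb : resH Set.subset_union_right 0 (homologyCls g hg) = 0) : homologyCls g hg = 0 := by
  have ha' := res_f_zero_eq_zero_of_resH Set.subset_union_left g hg ha
  have hb' := res_f_zero_eq_zero_of_resH Set.subset_union_right g hg hb
  rw [res_f_apply] at ha' hb'
  suffices hg0 : g = 0 by
    subst hg0
    exact homologyCls_zero _
  change ((chainsInSub R R X (A ∪ B)).toComplex.X 0 ⟶ N) at g
  change g = (0 : (chainsInSub R R X (A ∪ B)).toComplex.X 0 ⟶ N)
  ext x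
  obtain ⟨a, ha2, b, hb2, hab⟩ := Submodule.mem_sup.mp (chainsIn_union_zero_le A B x.2)
  have hx : x = (Subcomplex.incl (chainsInSub_mono R R (Set.subset_union_left : A ⊆ A ∪ B))).f 0
        (⟨a, ha2⟩ : (chainsInSub R R X A).toComplex.X 0) +
      (Subcomplex.incl (chainsInSub_mono R R (Set.subset_union_right : B ⊆ A ∪ B))).f 0
        (⟨b, hb2⟩ : (chainsInSub R R X B).toComplex.X 0) := by
    apply Subtype.ext
    exact hab.symm
  rw [hx, map_add]
  change ((Subcomplex.incl _).f 0 ≫ g) (⟨a, ha2⟩ : (chainsInSub R R X A).toComplex.X 0) +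
    ((Subcomplex.incl _).f 0 ≫ g) (⟨b, hb2⟩ : (chainsInSub R R X B).toComplex.X 0) = _
  rw [ha', hb']
  change (0 : N) + (0 : N) = (0 : N)
  rw [add_zero]

end subsetCochains

namespace Cech

variable {R : Type v} [CommRing R] {X : Type u} [TopologicalSpace X] {N : ModuleCat.{max u v} R}

/-- **`Ȟ⁰(A ∪ B) → Ȟ⁰(A) × Ȟ⁰(B)` is injective** (the Mayer–Vietoris sequence starts with
`0 → Ȟ⁰(A ∪ B) → …`; Miller 2020, Cor. 35.8). [cite: Miller2020, Cor. 35.8] -/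
theorem mvRes_zero_injective (A B : Set X) : Function.Injective (mvRes R N A B 0) := by
  rw [injective_iff_map_eq_zero]
  intro z hz
  obtain ⟨U, c, rfl⟩ := exists_of z
  have hA : restrict R N (Set.subset_union_left : A ⊆ A ∪ B) 0 (of R N U c) = 0 := congrArg Prod.fst hz
  have hB : restrict R N (Set.subset_union_right : B ⊆ A ∪ B) 0 (of R N U c) = 0 := congrArg Prod.snd hz
  rw [restrict_of, of_eq_zero_iff] at hA hB
  obtain ⟨W, hW, hWc⟩ := hA
  obtain ⟨Y, hY, hYc⟩ := hB
  obtain ⟨g, hg, rfl⟩ := homologyCls_surjective c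
  -- pass to `W ∪ Y ⊆ U`
  have hWY : U ≤ OpenNhd.union W Y := Set.union_subset hW hY
  rw [← of_res hWY]
  change of R N (OpenNhd.union W Y) (HomologicalComplex.homologyMap (subsetCochains.res R N hWY) 0 (homologyCls g hg)) = 0
  rw [homologyMap_homologyCls, subsetCochains.homologyCls_zero_eq_zero _ _ ?_ ?_, map_zero]
  · rw [← homologyMap_homologyCls]
    change (subsetCochains.resH hWY 0 ≫ subsetCochains.resH Set.subset_union_left 0) (homologyCls g hg) = 0
    rw [← HomologicalComplex.homologyMap_comp, ← subsetCochains.res_comp]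
    exact hWc
  · rw [← homologyMap_homologyCls]
    change (subsetCochains.resH hWY 0 ≫ subsetCochains.resH Set.subset_union_right 0) (homologyCls g hg) = 0
    rw [← HomologicalComplex.homologyMap_comp, ← subsetCochains.res_comp]
    exact hYc

end Cech

/-! ### The ladder and the five lemma -/

namespace CechDuality

variable {R : Type v} [CommRing R] {X : Type u} [TopologicalSpace X]

/-- Local notation: the coefficient object `ULift R` of `ModuleCat.{max u v} R` (`CechCapProduct.lean`). -/
local notation "𝑹" => SimplexSpan.coefR R

/-- Multiplying a map by `(-1)ᵏ` does not change bijectivity. [folklore] -/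
lemma bijective_neg_one_pow_smul_iff {V W' : Type*} [AddCommGroup V] [Module R V] [AddCommGroup W']
    [Module R W'] (k : ℕ) (f : V →ₗ[R] W') :
    Function.Bijective ((-1 : R) ^ k • f) ↔ Function.Bijective f := by
  have hinv : Function.Bijective (fun y : W' => (-1 : R) ^ k • y) :=
    Function.Involutive.bijective fun y => neg_one_pow_smul_neg_one_pow_smul k y
  have e : ⇑((-1 : R) ^ k • f) = (fun y : W' => (-1 : R) ^ k • y) ∘ f := rfl
  rw [e]
  constructor
  · intro h
    exact ⟨Function.Injective.of_comp h.1, fun w => by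
      obtain ⟨v, hv⟩ := h.2 ((-1 : R) ^ k • w)
      exact ⟨v, hinv.1 hv⟩⟩
  · intro h
    exact hinv.comp h

section Ladder

variable [T2Space X] {A B : Set X} (hA : IsCompact A) (hB : IsCompact B) {n : ℕ}
  (μ : clocalHomology R R X (A ∪ B) n)

/-- The first (restriction) square of the ladder: `(a ⌢ x)| = a| ⌢ x|` on both `A` and `B`
(Miller 2020, Thm. 36.2; naturality of the cechCap product). [cite: Miller2020, Thm. 36.2] -/
theorem mvRes_comp_cechCap {p q : ℕ} (h : p + q = n) :
    clocalHomology.mvRes R R A B q ∘ₗ cechCap (hA.union hB).isClosed h μ =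
      (LinearMap.prodMap (cechCap hA.isClosed h (clocalHomology.res R R X Set.subset_union_left n μ))
        (cechCap hB.isClosed h (clocalHomology.res R R X Set.subset_union_right n μ))) ∘ₗ
        Cech.mvRes R 𝑹 A B p := by
  apply LinearMap.ext
  intro a
  apply Prod.ext
  · change clocalHomology.res R R X Set.subset_union_left q (cechCap (hA.union hB).isClosed h μ a) =
      cechCap hA.isClosed h _ (Cech.restrict R 𝑹 Set.subset_union_left p a)
    exact res_cechCap (hA.union hB).isClosed hA.isClosed Set.subset_union_left h μ a
  · change clocalHomology.res R R X Set.subset_union_right q (cechCap (hA.union hB).isClosed h μ a) =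
      cechCap hB.isClosed h _ (Cech.restrict R 𝑹 Set.subset_union_right p a)
    exact res_cechCap (hA.union hB).isClosed hB.isClosed Set.subset_union_right h μ a

/-- The second (difference) square of the ladder: `(a| - b|) ⌢ x| = (a ⌢ x|)| - (b ⌢ x|)|`
(Miller 2020, Thm. 36.2). [cite: Miller2020, Thm. 36.2] -/
theorem mvDiff_comp_prodMap_cechCap {p q : ℕ} (h : p + q = n) :
    clocalHomology.mvDiff R R A B q ∘ₗ
      (LinearMap.prodMap (cechCap hA.isClosed h (clocalHomology.res R R X Set.subset_union_left n μ))
        (cechCap hB.isClosed h (clocalHomology.res R R X Set.subset_union_right n μ))) =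
      cechCap (hA.inter hB).isClosed h
          (clocalHomology.res R R X (Set.inter_subset_left.trans Set.subset_union_left : A ∩ B ⊆ A ∪ B) n μ) ∘ₗ
        Cech.mvDiff R 𝑹 A B p := by
  apply LinearMap.ext
  rintro ⟨a, b⟩
  change clocalHomology.res R R X Set.inter_subset_left q
        (cechCap hA.isClosed h (clocalHomology.res R R X Set.subset_union_left n μ) a) -
      clocalHomology.res R R X Set.inter_subset_right q
        (cechCap hB.isClosed h (clocalHomology.res R R X Set.subset_union_right n μ) b) =
    cechCap (hA.inter hB).isClosed h
      (clocalHomology.res R R X (Set.inter_subset_left.trans Set.subset_union_left : A ∩ B ⊆ A ∪ B) n μ)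
      (Cech.restrict R 𝑹 Set.inter_subset_left p a + -(Cech.restrict R 𝑹 Set.inter_subset_right p b))
  have eA : clocalHomology.res R R X Set.inter_subset_left n (clocalHomology.res R R X Set.subset_union_left n μ) =
      clocalHomology.res R R X (Set.inter_subset_left.trans Set.subset_union_left : A ∩ B ⊆ A ∪ B) n μ := by
    change (clocalHomology.res R R X _ n ≫ clocalHomology.res R R X _ n) μ = _
    rw [clocalHomology.res_comp_res]
  have eB : clocalHomology.res R R X Set.inter_subset_right n (clocalHomology.res R R X Set.subset_union_right n μ) =
      clocalHomology.res R R X (Set.inter_subset_left.trans Set.subset_union_left : A ∩ B ⊆ A ∪ B) n μ := by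
    change (clocalHomology.res R R X _ n ≫ clocalHomology.res R R X _ n) μ = _
    rw [clocalHomology.res_comp_res]
  rw [map_add, map_neg, res_cechCap hA.isClosed (hA.inter hB).isClosed Set.inter_subset_left h _ a,
    res_cechCap hB.isClosed (hA.inter hB).isClosed Set.inter_subset_right h _ b, eA, eB, sub_eq_add_neg]

/-- The third (connecting-map) square of the ladder, as an identity of linear maps with the sign
absorbed into the vertical map: `∂ ∘ ((-1)^{p+1} (- ⌢ x|)) = (- ⌢ x) ∘ δ` (`cechCap_mvδ`). [cite: Miller2020, Thm. 36.2] -/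
theorem mvδ_comp_smul_cechCap {p q' : ℕ} (hn : p + q' + 1 = n) :
    clocalHomology.mvδ R R hA.isClosed hB.isClosed q' ∘ₗ
      ((-1 : R) ^ (p + 1) • cechCap (hA.inter hB).isClosed (show p + (q' + 1) = n by omega)
        (clocalHomology.res R R X (Set.inter_subset_left.trans Set.subset_union_left : A ∩ B ⊆ A ∪ B) n μ)) =
      cechCap (hA.union hB).isClosed (show (p + 1) + q' = n by omega) μ ∘ₗ
        Cech.mvδ (N := 𝑹) hA hB p := by
  subst hn
  apply LinearMap.ext
  intro b
  rw [LinearMap.comp_apply, LinearMap.comp_apply, LinearMap.smul_apply, map_smul, cechCap_mvδ hA hB μ b]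

/-- **Miller's Mayer–Vietoris step (proof of Thm. 37.1, steps (2), (4))**: if capping with the
restrictions `x|_A`, `x|_B`, `x|_{A∩B}` of a class `x ∈ H_n(X | A ∪ B)` is bijective
`Ȟ^p → H_q(X | ·)` in all degrees, and `H_n(X | A ∪ B) → H_n(X | A) × H_n(X | B)` is injective
(as holds when `H_{n+1}(X | A ∩ B) = 0`), then capping with `x` is bijective in all degrees — by
the five lemma on the ladder of Thm. 36.2 (for `Ȟ⁰` by the four lemma at the left end of the
ladder). [cite: Miller2020, Thm. 37.1] -/
theorem bijective_cechCap_union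
    (hDA : ∀ (p q : ℕ) (h : p + q = n),
      Function.Bijective (cechCap hA.isClosed h (clocalHomology.res R R X Set.subset_union_left n μ) :
        Cech R 𝑹 A p → clocalHomology R R X A q))
    (hDB : ∀ (p q : ℕ) (h : p + q = n),
      Function.Bijective (cechCap hB.isClosed h (clocalHomology.res R R X Set.subset_union_right n μ) :
        Cech R 𝑹 B p → clocalHomology R R X B q))
    (hDAB : ∀ (p q : ℕ) (h : p + q = n),
      Function.Bijective (cechCap (hA.inter hB).isClosed h
        (clocalHomology.res R R X (Set.inter_subset_left.trans Set.subset_union_left : A ∩ B ⊆ A ∪ B) n μ) :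
        Cech R 𝑹 (A ∩ B) p → clocalHomology R R X (A ∩ B) q))
    (hinj : Function.Injective (clocalHomology.mvRes R R A B n))
    (p q : ℕ) (h : p + q = n) :
    Function.Bijective (cechCap (hA.union hB).isClosed h μ : Cech R 𝑹 (A ∪ B) p → clocalHomology R R X (A ∪ B) q) := by
  have hprod : ∀ (p q : ℕ) (h : p + q = n), Function.Bijective
      (LinearMap.prodMap (cechCap hA.isClosed h (clocalHomology.res R R X Set.subset_union_left n μ))
        (cechCap hB.isClosed h (clocalHomology.res R R X Set.subset_union_right n μ)) :
        Cech R 𝑹 A p × Cech R 𝑹 B p →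
          clocalHomology R R X A q × clocalHomology R R X B q) := fun p q h =>
    ⟨fun x y hxy => Prod.ext ((hDA p q h).1 (congrArg Prod.fst hxy)) ((hDB p q h).1 (congrArg Prod.snd hxy)),
      fun ⟨a, b⟩ => by
        obtain ⟨a', ha'⟩ := (hDA p q h).2 a
        obtain ⟨b', hb'⟩ := (hDB p q h).2 b
        exact ⟨(a', b'), Prod.ext ha' hb'⟩⟩
  cases p with
  | zero =>
    -- four lemma at the left end of the ladder
    obtain rfl : q = n := by omega
    exact LinearMap.bijective_of_bijective_of_injective_of_left_exact
      (Cech.mvRes R 𝑹 A B 0) (Cech.mvDiff R 𝑹 A B 0)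
      (clocalHomology.mvRes R R A B q) (clocalHomology.mvDiff R R A B q)
      (cechCap (hA.union hB).isClosed h μ)
      (LinearMap.prodMap (cechCap hA.isClosed h (clocalHomology.res R R X Set.subset_union_left q μ))
        (cechCap hB.isClosed h (clocalHomology.res R R X Set.subset_union_right q μ)))
      (cechCap (hA.inter hB).isClosed h
        (clocalHomology.res R R X (Set.inter_subset_left.trans Set.subset_union_left : A ∩ B ⊆ A ∪ B) q μ))
      (mvRes_comp_cechCap hA hB μ h) (mvDiff_comp_prodMap_cechCap hA hB μ h)
      (Cech.mv_exact₂ hA hB 0) (clocalHomology.mv_exact₂ R R hA.isClosed hB.isClosed q)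
      (hprod 0 q h) (hDAB 0 q h).1 (Cech.mvRes_zero_injective A B) hinj
  | succ p' =>
    -- five lemma
    have h' : p' + (q + 1) = n := by omega
    have hn : p' + q + 1 = n := by omega
    have hi₂ := (bijective_neg_one_pow_smul_iff (p' + 1) _).mpr (hDAB p' (q + 1) h')
    have hi₁ := (bijective_neg_one_pow_smul_iff (p' + 1) _).mpr (hprod p' (q + 1) h')
    refine LinearMap.bijective_of_surjective_of_bijective_of_bijective_of_injective
      (Cech.mvDiff R 𝑹 A B p') (Cech.mvδ (N := 𝑹) hA hB p')
      (Cech.mvRes R 𝑹 A B (p' + 1)) (Cech.mvDiff R 𝑹 A B (p' + 1))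
      (clocalHomology.mvDiff R R A B (q + 1)) (clocalHomology.mvδ R R hA.isClosed hB.isClosed q)
      (clocalHomology.mvRes R R A B q) (clocalHomology.mvDiff R R A B q)
      ((-1 : R) ^ (p' + 1) • LinearMap.prodMap
        (cechCap hA.isClosed h' (clocalHomology.res R R X Set.subset_union_left n μ))
        (cechCap hB.isClosed h' (clocalHomology.res R R X Set.subset_union_right n μ)))
      ((-1 : R) ^ (p' + 1) • cechCap (hA.inter hB).isClosed h'
        (clocalHomology.res R R X (Set.inter_subset_left.trans Set.subset_union_left : A ∩ B ⊆ A ∪ B) n μ))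
      (cechCap (hA.union hB).isClosed h μ)
      (LinearMap.prodMap (cechCap hA.isClosed h (clocalHomology.res R R X Set.subset_union_left n μ))
        (cechCap hB.isClosed h (clocalHomology.res R R X Set.subset_union_right n μ)))
      (cechCap (hA.inter hB).isClosed h
        (clocalHomology.res R R X (Set.inter_subset_left.trans Set.subset_union_left : A ∩ B ⊆ A ∪ B) n μ))
      ?_ ?_ (mvRes_comp_cechCap hA hB μ h) (mvDiff_comp_prodMap_cechCap hA hB μ h)
      (Cech.mv_exact₃ hA hB p') (Cech.mv_exact₁ hA hB p') (Cech.mv_exact₂ hA hB (p' + 1))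
      (clocalHomology.mv_exact₃ R R hA.isClosed hB.isClosed q)
      (clocalHomology.mv_exact₁ R R hA.isClosed hB.isClosed q)
      (clocalHomology.mv_exact₂ R R hA.isClosed hB.isClosed q)
      hi₁.2 hi₂ (hprod (p' + 1) q h) (hDAB (p' + 1) q h).1
    · rw [LinearMap.comp_smul, LinearMap.smul_comp, mvDiff_comp_prodMap_cechCap hA hB μ h']
    · rw [mvδ_comp_smul_cechCap hA hB μ hn]

end Ladder

end CechDuality

end Literature.AlgebraicTopology.SingularHomology
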